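import Summits.QuantumFields.BalabanUV.T4Continuum.Support.NE7K1LinBlochSymbol
import Summits.QuantumFields.BalabanUV.T4Continuum.Support.NE7K1LinBlochSymbolZone
import Summits.QuantumFields.BalabanUV.T4Continuum.Support.NE7K1LinBlochSymbolFloor

/-!
# NE7K1LinBlochSymbolScaled — row NE7 (node U5), candidate route HOM, path H1L, cell K1-lin(s): NEEDS-ESTIMATE #E1, B-E1 TYPED —
# THE SCALED MULTIPLIER `n²·k_L(p∕n)` (the block-mean symbol on the `ξ = 1∕n` lattice, the object that replaces b04's
# `S_ξ(z) = n²S₁(z∕n)` in the strip engine): modulus bound with the quadratic vanishing, the real-zone window against `Δ^ξ_n`, and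
# the off-axis real-part floor — ALL UNIFORM IN `n ≥ 1` (and in `L ≥ 1`, constants in `d` alone)

Lineage `b2b-balaban-t4-ne7-p2` (CRUX PROVER NE7 #2), generation 74; file 52.  Files 47–51 typed B-E1's clauses for `k_L` on the unit
coarse lattice.  The strip engine (`B4StripCauchy` §2) consumes its Laplacian symbol at scale `ξ = 1∕n`: `S_ξ(z) = n²·S₁(z∕n)` with
bounds UNIFORM IN `n` («`|S_ξ(x+iy)| ≤ x² + (25∕16)y²`», «`Re S_ξ ≥ 4n²sin²(x∕2n) − (25∕16)y²`»).  Lens 2's S-64-1 §3 states the clauses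
of `k_L` in exactly that scaled form («the scaled symbol `n²k_L(p∕n)` obeys the SAME bound n-uniformly», «`Re[n²k_L((x+iy)∕n)] ≥
n²k_L(x∕n) − C_S|y|_∞²` UNIFORM IN n precisely because the error is QUADRATIC»).  THIS FILE derives them from files 48, 49, 51 by the
substitution `p ↦ p∕n` ([folklore]; no new estimate):

* §1 `scale_mem_strip`: `|Re p_μ| ≤ πn`, `|Im p_μ| ≤ κn` ⇒ `p∕n ∈ Strip d κ`; `DeltaXir_eq_scaled : Δ^ξ_n(x) = n²·Δ¹(x∕n)`.
* §2 **`norm_kL_scaled_le`**: `‖n²·k_L(p∕n)‖ ≤ c_N(d)⁻¹·Σ_μ((Re p_μ)² + (25∕16)(Im p_μ)²)` for `|Re p_μ| ≤ πn`, `|Im p_μ| ≤ κ_N(d)·n` —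
  b04's `norm_Sxi_le` shape with `1 ↦ c_N(d)⁻¹`, uniform in `n ≥ 1` and `L ≥ 1` (file 48's `norm_kL_le_quad` at `p∕n`).
* §3 **`kLr_scaled_window`**: `Δ^ξ_n(x) ≤ n²·k_L(x∕n) ≤ (π²∕4)^{d+1}·Δ^ξ_n(x)` for `|x_μ| ≤ πn` (file 49's window at `x∕n`) — the
  scaled multiplier is comparable to b04's own real symbol `DeltaXir n 0`, uniformly in `n`.
* §4 **`re_kL_scaled_ge_sub_sq`**: for `|x_μ| ≤ πn`, `0 ≤ y < κ_F(d)·n`, `|η_μ| ≤ y`: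
  `n²·k_L(x∕n) − (4B_F(d)∕κ_F(d)²)·y² ≤ Re[n²·k_L((x + iη)∕n)]` — file 51's floor at `(x∕n, η∕n, y∕n)`, the factor `n²` cancelling
  against `(y∕n)²`: UNIFORM IN `n` (b04's `re_Sxi_ge` shape with `25∕16 ↦ 4B_F∕κ_F²`); with §3, `≥ Δ^ξ_n(x) − C·y²`
  (`re_kL_scaled_ge_DeltaXir_sub_sq`).

HONEST FRAMING: [folklore] (change of variables only); constants existence-grade and `d`-only; the class-S re-typing of the engine
(R-E1) that would consume these clauses is untouched; the identification with the finite-torus symbol is NOT typed; nothing of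
Bałaban's asserted; no `sorry`.  Census only; NE7 NOT PRINTED ∕ NOT PROVED; spine 0∕9; FIXED FINITE T⁴, rung (B)+1; NOT infinite
volume, NOT mass gap, NOT Clay.  HONEST DEPENDENCY: continuum YM on T⁴ ⇐ BetaPertH ∧ nine spine estimates (0/9 proved); BetaPertH ⇐
(D1) ∧ (D4) ∧ CAP+tail; G-an2-4 gates asym, D1 and NE2/3/4.
-/

noncomputable section

open Finset Complex Set

namespace Summit.QuantumFields.BalabanUV.T4Continuum.NE7K1LinBlochSymbolScaled

open Literature.MathematicalPhysics.QuantumFieldTheory.Balaban1983to89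
open Literature.MathematicalPhysics.QuantumFieldTheory.Balaban1983to89.B4Strip
open Literature.MathematicalPhysics.QuantumFieldTheory.Balaban1983to89.B4StripCauchy
open NE7K1LinBlochDenominator NE7K1LinBlochSymbol NE7K1LinBlochSymbolZone NE7K1LinBlochDenominatorFat NE7K1LinBlochSymbolFloor

variable {d : ℕ}

/-! ### §1 Scaling bookkeeping -/

/-- real and imaginary parts of `p_μ ∕ n`. [folklore] -/
theorem div_nat_re_im (z : ℂ) (n : ℕ) : (z / (n : ℂ)).re = z.re / n ∧ (z / (n : ℂ)).im = z.im / n := by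
  have e : (n : ℂ) = ((n : ℝ) : ℂ) := by norm_cast
  rw [e, div_ofReal_re, div_ofReal_im]
  exact ⟨rfl, rfl⟩

/-- `|Re p_μ| ≤ πn`, `|Im p_μ| ≤ κn` ⇒ `p∕n ∈ Strip d κ`. [folklore] -/
theorem scale_mem_strip {n : ℕ} (hn : 1 ≤ n) {κ : ℝ} {p : Fin d → ℂ}
    (hp : ∀ μ, |(p μ).re| ≤ Real.pi * n ∧ |(p μ).im| ≤ κ * n) : (fun μ => p μ / (n : ℂ)) ∈ Strip d κ := by
  have hn0 : (0 : ℝ) < n := by exact_mod_cast (show 0 < n by omega)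
  intro μ
  obtain ⟨h1, h2⟩ := hp μ
  obtain ⟨er, ei⟩ := div_nat_re_im (p μ) n
  rw [er, ei, abs_div, abs_div, abs_of_pos hn0, div_le_iff₀ hn0, div_le_iff₀ hn0]
  exact ⟨h1, h2⟩

/-- `|x_μ| ≤ πn` ⇒ `|x_μ∕n| ≤ π`. [folklore] -/
theorem scale_mem_zone {n : ℕ} (hn : 1 ≤ n) {x : Fin d → ℝ} (hx : ∀ μ, |x μ| ≤ Real.pi * n) :
    ∀ μ, |x μ / n| ≤ Real.pi := by
  have hn0 : (0 : ℝ) < n := by exact_mod_cast (show 0 < n by omega)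
  intro μ
  rw [abs_div, abs_of_pos hn0, div_le_iff₀ hn0]
  exact hx μ

/-- `Δ^ξ_n(x) = n²·Δ¹(x∕n)` (`S_ξ(x) = n²S₁(x∕n)` summed over the coordinates). [folklore] -/
theorem DeltaXir_eq_scaled (n : ℕ) (x : Fin d → ℝ) : DeltaXir n 0 x = (n : ℝ) ^ 2 * Delta1r 0 (fun μ => x μ / n) := by
  unfold DeltaXir Delta1r Sxir S1r
  rw [add_zero, add_zero, Finset.mul_sum]

/-! ### §2 The modulus bound with the quadratic vanishing, uniform in `n` -/

/-- **MODULUS BOUND OF THE SCALED MULTIPLIER, UNIFORM IN `n ≥ 1`** (clause (c′) in the engine's form): for `|Re p_μ| ≤ πn` and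
`|Im p_μ| ≤ κ_N(d)·n`:  `‖n²·k_L(p∕n)‖ ≤ c_N(d)⁻¹ · Σ_μ ((Re p_μ)² + (25∕16)(Im p_μ)²)` — b04's `|S_ξ(x+iy)| ≤ x² + (25∕16)y²` with
`1 ↦ c_N(d)⁻¹`, every `L ≥ 1`. [folklore] -/
theorem norm_kL_scaled_le (L : ℕ) [NeZero L] {n : ℕ} (hn : 1 ≤ n) {p : Fin d → ℂ}
    (hp : ∀ μ, |(p μ).re| ≤ Real.pi * n ∧ |(p μ).im| ≤ kappaN d * n) :
    ‖(n : ℂ) ^ 2 * kL L (fun μ => p μ / (n : ℂ))‖ ≤ (∑ μ, ((p μ).re ^ 2 + 25 / 16 * (p μ).im ^ 2)) / cN d := by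
  have hn0 : (0 : ℝ) < n := by exact_mod_cast (show 0 < n by omega)
  have h := norm_kL_le_quad L (scale_mem_strip hn hp)
  have e : ∑ μ, (((fun μ => p μ / (n : ℂ)) μ).re ^ 2 + 25 / 16 * ((fun μ => p μ / (n : ℂ)) μ).im ^ 2)
      = (∑ μ, ((p μ).re ^ 2 + 25 / 16 * (p μ).im ^ 2)) / (n : ℝ) ^ 2 := by
    rw [Finset.sum_div]
    refine Finset.sum_congr rfl (fun μ _ => ?_)
    obtain ⟨er, ei⟩ := div_nat_re_im (p μ) n
    simp only [er, ei]
    field_simp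
  rw [e] at h
  rw [norm_mul, norm_pow, Complex.norm_natCast]
  calc (n : ℝ) ^ 2 * ‖kL L fun μ => p μ / (n : ℂ)‖
      ≤ (n : ℝ) ^ 2 * ((∑ μ, ((p μ).re ^ 2 + 25 / 16 * (p μ).im ^ 2)) / (n : ℝ) ^ 2 / cN d) :=
        mul_le_mul_of_nonneg_left h (by positivity)
    _ = (∑ μ, ((p μ).re ^ 2 + 25 / 16 * (p μ).im ^ 2)) / cN d := by
        generalize (∑ μ, ((p μ).re ^ 2 + 25 / 16 * (p μ).im ^ 2)) = S
        field_simp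

/-! ### §3 The window against `Δ^ξ_n` on the scaled zone, uniform in `n` -/

/-- **THE SCALED WINDOW** (clause (d′)∕(c′) on the real zone, in the engine's variables): for `|x_μ| ≤ πn`, every `n ≥ 1`, `L ≥ 1`:
`Δ^ξ_n(x) ≤ n²·k_L(x∕n) ≤ (π²∕4)^{d+1}·Δ^ξ_n(x)` — the scaled block-mean multiplier is comparable to b04's own real symbol
`DeltaXir n 0`, uniformly in `n`. [folklore] -/
theorem kLr_scaled_window (L : ℕ) [NeZero L] {n : ℕ} (hn : 1 ≤ n) (x : Fin d → ℝ) (hx : ∀ μ, |x μ| ≤ Real.pi * n) :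
    DeltaXir n 0 x ≤ (n : ℝ) ^ 2 * kLr L (fun μ => x μ / n) ∧
      (n : ℝ) ^ 2 * kLr L (fun μ => x μ / n) ≤ (Real.pi ^ 2 / 4) ^ (d + 1) * DeltaXir n 0 x := by
  obtain ⟨hlo, hhi⟩ := kLr_window L (fun μ => x μ / n) (scale_mem_zone hn hx)
  have hn2 : (0 : ℝ) ≤ (n : ℝ) ^ 2 := by positivity
  rw [DeltaXir_eq_scaled]
  constructor
  · exact mul_le_mul_of_nonneg_left hlo hn2
  · calc (n : ℝ) ^ 2 * kLr L (fun μ => x μ / n)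
        ≤ (n : ℝ) ^ 2 * ((Real.pi ^ 2 / 4) ^ (d + 1) * Delta1r 0 (fun μ => x μ / n)) := mul_le_mul_of_nonneg_left hhi hn2
      _ = (Real.pi ^ 2 / 4) ^ (d + 1) * ((n : ℝ) ^ 2 * Delta1r 0 (fun μ => x μ / n)) := by ring

/-- the scaled multiplier is real and non-negative on the scaled zone: `n²·k_L(x∕n) = n²·kLr_L(x∕n) ≥ 0`. [folklore] -/
theorem kL_scaled_ofReal (L : ℕ) [NeZero L] (n : ℕ) (x : Fin d → ℝ) :
    (n : ℂ) ^ 2 * kL L (fun μ => ((x μ : ℂ)) / (n : ℂ)) = ((((n : ℝ) ^ 2 * kLr L (fun μ => x μ / n) : ℝ)) : ℂ) := by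
  have e : (fun μ => ((x μ : ℂ)) / (n : ℂ)) = ofRealVec (fun μ => x μ / n) := by
    funext μ; simp [ofRealVec]
  rw [e, kL_ofReal]
  push_cast
  ring

/-! ### §4 The off-axis real-part floor, uniform in `n` -/

/-- **THE OFF-AXIS FLOOR OF THE SCALED MULTIPLIER, UNIFORM IN `n ≥ 1`** (clauses (a′)(b′) in the engine's form): for `|x_μ| ≤ πn`,
`0 ≤ y < κ_F(d)·n` and `|η_μ| ≤ y`:  `n²·k_L(x∕n) − (4B_F(d)∕κ_F(d)²)·y² ≤ Re[n²·k_L((x + iη)∕n)]`, `B_F(d) = 16d∕c_F(d)` — the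
error constant does NOT see `n` (the quadratic error `(y∕n)²` against the prefactor `n²`). [folklore] -/
theorem re_kL_scaled_ge_sub_sq (L : ℕ) [NeZero L] {n : ℕ} (hn : 1 ≤ n) {x η : Fin d → ℝ}
    (hx : ∀ μ, |x μ| ≤ Real.pi * n) {y : ℝ} (hy0 : 0 ≤ y) (hyR : y < kappaF d * n) (hη : ∀ μ, |η μ| ≤ y) :
    (n : ℝ) ^ 2 * kLr L (fun μ => x μ / n) - 4 * (16 * d / cF d) / kappaF d ^ 2 * y ^ 2
      ≤ ((n : ℂ) ^ 2 * kL L (fun μ => ((x μ : ℂ) + (η μ : ℂ) * I) / (n : ℂ))).re := by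
  have hn0 : (0 : ℝ) < n := by exact_mod_cast (show 0 < n by omega)
  have hu : ∀ μ, |(fun μ => x μ / n) μ| ≤ Real.pi := scale_mem_zone hn hx
  have hy0' : 0 ≤ y / n := div_nonneg hy0 hn0.le
  have hyR' : y / n < kappaF d := by rw [div_lt_iff₀ hn0]; exact hyR
  have hη' : ∀ μ, |(fun μ => η μ / n) μ| ≤ y / n := fun μ => by
    simp only; rw [abs_div, abs_of_pos hn0]; exact div_le_div_of_nonneg_right (hη μ) hn0.le
  have h := re_kL_ge_sub_sq L hu hy0' hyR' hη'
  have eP : (fun ν => (((fun μ => x μ / (n : ℝ)) ν : ℝ) : ℂ) + (((fun μ => η μ / (n : ℝ)) ν : ℝ) : ℂ) * I)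
      = fun μ => ((x μ : ℂ) + (η μ : ℂ) * I) / (n : ℂ) := by
    funext μ
    have hnC : (n : ℂ) ≠ 0 := by exact_mod_cast (show n ≠ 0 by omega)
    push_cast
    field_simp
  rw [eP] at h
  have ere : ((n : ℂ) ^ 2 * kL L (fun μ => ((x μ : ℂ) + (η μ : ℂ) * I) / (n : ℂ))).re
      = (n : ℝ) ^ 2 * (kL L (fun μ => ((x μ : ℂ) + (η μ : ℂ) * I) / (n : ℂ))).re := by
    have : (n : ℂ) ^ 2 = (((n : ℝ) ^ 2 : ℝ) : ℂ) := by push_cast; ring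
    rw [this, re_ofReal_mul]
  rw [ere]
  have hmul := mul_le_mul_of_nonneg_left h (by positivity : (0 : ℝ) ≤ (n : ℝ) ^ 2)
  have e2 : (n : ℝ) ^ 2 * (kLr L (fun μ => x μ / n) - 4 * (16 * d / cF d) / kappaF d ^ 2 * (y / n) ^ 2)
      = (n : ℝ) ^ 2 * kLr L (fun μ => x μ / n) - 4 * (16 * d / cF d) / kappaF d ^ 2 * y ^ 2 := by
    field_simp
  rw [e2] at hmul
  exact hmul

/-- **THE SHIFTED FLOOR AGAINST b04's REAL SYMBOL**: for `|x_μ| ≤ πn`, `0 ≤ y < κ_F(d)·n`, `|η_μ| ≤ y`, every `n ≥ 1`, `L ≥ 1`: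
`Δ^ξ_n(x) − (4B_F(d)∕κ_F(d)²)·y² ≤ Re[n²·k_L((x + iη)∕n)]` (§3's lower window + §4) — the exact shape of `B4StripCauchy.re_Sxi_ge`
(`4n²sin²(x∕2n) − (25∕16)y² ≤ Re S_ξ(x+iy)`) for the block-mean multiplier. [folklore] -/
theorem re_kL_scaled_ge_DeltaXir_sub_sq (L : ℕ) [NeZero L] {n : ℕ} (hn : 1 ≤ n) {x η : Fin d → ℝ}
    (hx : ∀ μ, |x μ| ≤ Real.pi * n) {y : ℝ} (hy0 : 0 ≤ y) (hyR : y < kappaF d * n) (hη : ∀ μ, |η μ| ≤ y) :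
    DeltaXir n 0 x - 4 * (16 * d / cF d) / kappaF d ^ 2 * y ^ 2
      ≤ ((n : ℂ) ^ 2 * kL L (fun μ => ((x μ : ℂ) + (η μ : ℂ) * I) / (n : ℂ))).re := by
  have h1 := (kLr_scaled_window L hn x hx).1
  have h2 := re_kL_scaled_ge_sub_sq L hn hx hy0 hyR hη
  linarith

end Summit.QuantumFields.BalabanUV.T4Continuum.NE7K1LinBlochSymbolScaled

end
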